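import Summits.CriticalPhenomena.Ising3DConformalLimit.Theses.ReflectionTwin
import Literature.Probability.LatticeModels.TwistCorrBoxLimit
import HarnessLib

/-!
# Stub `stub_replicaLower` of line `replica-mirror` (crux `ReflectionTwin.TwinTransparency`, stmt-CriticalPhenomena-16905)

The REPLICA TWIN of `ℤ³` resamples the lower half-crystal `{h ≤ -1}` (`h z = z₀ + z₁ + z₂`) of a critical
free-box sample given the rest, and pairs OLD spins (points of `w` on/below the plane `x₀ + x₁ + x₂ = 0`, read at
`[wᵢ/δ]`) with NEW spins (points above the plane, reflected by `θ` and read in the resampled configuration):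
`replicaBox L k old z = ⟨(∏_{old i} σ_{zᵢ}) · E[∏_{¬ old i} σ'_{zᵢ} | spins off {h ≤ -1}]⟩^∅_{box 3 L; β_c(3)}`,
a `PairIsing.gibbsAvg` for the nearest-neighbour couplings `β_c(3)/2 · 𝟙{‖a - b‖₁ = 1}` (ordered pairs) with the
exact conditional resampling written as a ratio of restricted partition sums, and
`replicaFold δ k w = limsup_L replicaBox L k (hw ≤ 0) [fold w / δ]`.

`stub_replicaLower` is the ALL-LOWER instance: if every point of `w` lies strictly below the plane then
`ρ(δ)^k · replicaFold δ k w → S k w` as `δ → 0⁺` for every pointwise scaling limit `S` of the critical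
correlators (`HasPointwiseScalingLimit (criticalCorr 3) ρ S`) and every non-coincident `w`. Proof (an identity
plus the hypothesis):
* every point is OLD, so the fold is the identity (`if_pos`), the NEW monomial is the empty product `1`, and the
  conditional expectation of `1` is `Z'/Z' = 1` (the conditioning class of `s` contains `s`, Boltzmann weights
  are positive: `PairIsing.gibbsWeight_pos`, `Finset.sum_pos`, `div_self`);
* hence `replicaBox L k old [w/δ]` is the free-box bulk correlator `⟨∏ᵢ σ_{[wᵢ/δ]}⟩^∅_{box 3 L; β_c(3)}`, which is
  the tree's untwisted twisted-box correlator `twistCorr L 0 0 0 k [w/δ]` (`twistCouplings_zero_right`,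
  `zdGraph_adj_iff_norm_holds`; `PairIsing.gibbsAvg = PairIsing.avg` definitionally);
* its box limit is `criticalCorr 3 k [w/δ]` (`tendsto_twistCorr_zero_right`: GKS monotone limit = free state =
  plus state at `β_c(3)`, Aizenman–Duminil-Copin–Sidoravicius 2015 through `criticalCorr_wellDefined_holds`), so
  the `limsup` is that limit (`Filter.Tendsto.limsup_eq`) and `ρ(δ)^k · replicaFold δ k w =
  rescaledCorrelator (criticalCorr 3) ρ k δ w` for every `δ` (`rescaledCorrelator_apply`);
* the hypothesis gives the pointwise limit at `w ∈ NonCoincident 3 k` (`TendstoLocallyUniformlyOn.tendsto_at`).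

References: S. Friedli, Y. Velenik, *Statistical Mechanics of Lattice Systems* (CUP 2017), §3.6, Exercises 3.12,
3.16 (free-state box limit by GKS); M. Aizenman, H. Duminil-Copin, V. Sidoravicius, Comm. Math. Phys. 334 (2015),
Thm. 1.2 (free = plus at `β_c`, `d = 3`). No definitions, no new named facts; three private helpers.
-/

noncomputable section

namespace Summit.CriticalPhenomena.Ising3DConformalLimit.Cruxes.TwinTransparency.ReplicaMirror

open scoped BigOperators Topology Manifold Classical MeasureTheory ProbabilityTheory Matrix InnerProductSpace ComplexConjugate ContinuousMap
open Filter Set Function TopologicalSpace MeasureTheory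
open Literature.Probability.LatticeModels

/-! ## The free-box bulk correlator is the untwisted twisted-box correlator -/

/-- The free-box nearest-neighbour critical couplings `β_c(3)/2 · 𝟙{‖a - b‖₁ = 1}` of `ℤ³` (ordered pairs) are
the tree's twist couplings with zero Burgers number, `twistCouplings L 0 0 0` (`twistCouplings_zero_right` and
`x ∼ y ↔ ‖x - y‖₁ = 1`, `zdGraph_adj_iff_norm_holds`). [folklore] -/
private theorem nnCouplings_eq_twistCouplings (L : ℕ) :
    (fun a b : ↥(box 3 L) => if (∑ i, |a.1 i - b.1 i| = 1) then criticalBeta 3 / 2 else (0:ℝ)) =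
      twistCouplings L 0 0 0 := by
  funext a b
  rw [twistCouplings_zero_right]
  exact if_congr (zdGraph_adj_iff_norm_holds a.1 b.1).symm rfl rfl

/-- Hence the free-box bulk correlator `⟨∏ᵢ σ_{zᵢ}⟩^∅_{box 3 L; β_c(3)}` (a `PairIsing.gibbsAvg`, with the junk
factor `0` for a site off the box) IS the untwisted twisted-box correlator `twistCorr L 0 0 0 k z` of
`TwistCorr.lean` (`PairIsing.gibbsAvg` and `PairIsing.avg` agree definitionally). [folklore] -/
private theorem gibbsAvg_nn_eq_twistCorr (L k : ℕ) (z : Fin k → Site 3) :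
    PairIsing.gibbsAvg (fun a b : ↥(box 3 L) => if (∑ i, |a.1 i - b.1 i| = 1) then criticalBeta 3 / 2 else (0:ℝ))
        (fun s => ∏ i, if h : z i ∈ box 3 L then spinAt (⟨z i, h⟩ : ↥(box 3 L)) s else 0) =
      twistCorr L 0 0 0 k z := by
  rw [nnCouplings_eq_twistCouplings]
  rfl

/-- A restricted partition sum over a conditioning class of the form `{s' | ∀ a, q a → s' a = s a}` is nonzero:
the class contains `s` itself and Boltzmann weights are positive. [folklore] -/
private theorem sum_filter_gibbsWeight_ne_zero {ι : Type*} [Fintype ι] [DecidableEq ι] (c : ι → ι → ℝ)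
    (q : ι → Prop) (s : SpinConfig ι) {_ : DecidablePred fun s' : SpinConfig ι => ∀ a, q a → s' a = s a} :
    (∑ s' ∈ Finset.univ.filter (fun s' : SpinConfig ι => ∀ a, q a → s' a = s a), PairIsing.gibbsWeight c s') ≠ 0 :=
  (Finset.sum_pos (fun s' _ => PairIsing.gibbsWeight_pos c s')
    ⟨s, Finset.mem_filter.2 ⟨Finset.mem_univ s, fun _ _ => rfl⟩⟩).ne'

/-- **stub_replicaLower (S4 — THE ALL-LOWER INSTANCE OF THE REPLICA MIRROR; provable now, size S–M).** For a
configuration `w` strictly below the plane every point is OLD, the conditional resampling factor is `condLow L 1 = 1`,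
and `replicaBox` is the free-box critical bulk correlator `⟨∏ᵢ σ_{[wᵢ/δ]}⟩^∅_{box L; β_c(3)}`, whose box limit is
`criticalCorr 3 k [w/δ]` (free = plus at `β_c(3)`: `tendsto_isingExpect_free_spinMonomial` /
`criticalCorr_wellDefined_holds`, cf. `twistCorr_zero_right` for the identification of `PairIsing` box averages at
the n.n. couplings `β_c/2` with `isingExpect … .free`), so the `limsup` is that limit (`Tendsto.limsup_eq`) and
`ρ(δ)^k · replicaFold δ k w = rescaledCorrelator (criticalCorr 3) ρ k δ w → S k w` pointwise on `NonCoincident`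
(`TendstoLocallyUniformlyOn.tendsto_at`). [cite: AizenmanDuminilCopinSidoraviciusCMP2015, Thm. 1.2 with Cor. 1.5 (1)]
[cite: FriedliVelenik2017, Exercise 3.16] -/
theorem stub_replicaLower :
    (fun (replicaFold : ℝ → (k : ℕ) → (Fin k → EuclideanSpace ℝ (Fin 3)) → ℝ) => ∀ (ρ : ℝ → ℝ) (S : CorrFamily 3), HasPointwiseScalingLimit (criticalCorr 3) ρ S → ∀ (k : ℕ), ∀ w ∈ NonCoincident 3 k, (∀ i, w i 0 + w i 1 + w i 2 < 0) → Filter.Tendsto (fun δ : ℝ => ρ δ ^ k * replicaFold δ k w) (𝓝[>] (0:ℝ)) (𝓝 (S k w))) (fun (δ : ℝ) (k : ℕ) (w : Fin k → EuclideanSpace ℝ (Fin 3)) => Filter.limsup (fun L : ℕ => (fun (L k : ℕ) (old : Fin k → Prop) (z : Fin k → Site 3) => PairIsing.gibbsAvg (fun a b : ↥(box 3 L) => if (∑ i, |a.1 i - b.1 i| = 1) then criticalBeta 3 / 2 else (0:ℝ)) (fun s => (∏ i, if old i then (if h : z i ∈ box 3 L then spinAt (⟨z i, h⟩ : ↥(box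 3 L)) s else 0) else 1) * (fun (g : SpinConfig ↥(box 3 L) → ℝ) (s : SpinConfig ↥(box 3 L)) => (∑ s' ∈ Finset.univ.filter (fun s' : SpinConfig ↥(box 3 L) => ∀ a : ↥(box 3 L), ¬ (a.1 0 + a.1 1 + a.1 2 ≤ -1) → s' a = s a), g s' * PairIsing.gibbsWeight (fun a b : ↥(box 3 L) => if (∑ i, |a.1 i - b.1 i| = 1) then criticalBeta 3 / 2 else (0:ℝ)) s') / (∑ s' ∈ Finset.univ.filter (fun s' : SpinConfig ↥(box 3 L) => ∀ a : ↥(box 3 L), ¬ (a.1 0 + a.1 1 + a.1 2 ≤ -1) → s' a = s a), PairIsing.gibbsWeight (fun a b : ↥(box 3 L) => if (∑ i, |a.1 i - b.1 i| = 1) then criticalBeta 3 / 2 else (0:ℝ)) s')) (fun s' => ∏ i, if old i then 1 else (if h : z i ∈ box 3 L then spinAt (⟨z i, h⟩ : ↥(box 3 L)) s' else 0)) s)) L k (fun i => w i 0 + w i 1 + w i 2 ≤ 0) (fun i => latticeApprox δ ((fun v : EuclideanSpace ℝ (Fin 3) => if v 0 + v 1 + v 2 ≤ 0 then v else (fun v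 : EuclideanSpace ℝ (Fin 3) => ((ℝ ∙ (EuclideanSpace.single 0 1 + EuclideanSpace.single 1 1 + EuclideanSpace.single 2 1 : EuclideanSpace ℝ (Fin 3)))ᗮ).reflection v) v) (w i)))) Filter.atTop) := by
  intro ρ S hlim k w hw hlow
  have hle : ∀ i, w i 0 + w i 1 + w i 2 ≤ 0 := fun i => (hlow i).le
  -- pointwise in `δ`: `ρ δ ^ k * replicaFold δ k w = rescaledCorrelator (criticalCorr 3) ρ k δ w`
  refine ((hlim k).tendsto_at hw).congr fun δ => ?_
  rw [rescaledCorrelator_apply]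
  congr 1
  -- the `limsup` over boxes is the box limit `criticalCorr 3 k [w/δ]` of the bulk correlator
  refine (Filter.Tendsto.limsup_eq ?_).symm
  refine (tendsto_twistCorr_zero_right 0 k _ 0).congr fun L => ?_
  -- all points are OLD: the fold is the identity, the NEW monomial is `1`, the conditional factor is `Z'/Z'`
  simp only [hle, if_true, Finset.prod_const_one, one_mul]
  rw [← gibbsAvg_nn_eq_twistCorr]
  refine congrArg (PairIsing.gibbsAvg _) (funext fun s => ?_)
  rw [div_self (sum_filter_gibbsWeight_ne_zero _ _ _), mul_one]

end Summit.CriticalPhenomena.Ising3DConformalLimit.Cruxes.TwinTransparency.ReplicaMirror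

end
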